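import Literature.Geometry.Kaehler.ComplexTorusHodgeRationalEndSemisimple
import HarnessLib

/-!
# The operative form of André's Prop. 3.3 on the torus: every rational Hodge endomorphism `u` of `H•(X; ℚ)` has a quasi-inverse `u v u = u` in
# `End_{ℚ-HS}(H•(X; ℚ))`, so its image and kernel are cut out by rational Hodge PROJECTORS `e = u v`, `f = v u` (Jannsen's Lemma 2 mechanism)

Layer `Literature/Geometry/Kaehler`, namespace `Literature.Geometry.Kaehler.ComplexTorus`; lane `lit-hodgefound` (Track 2 foundations library),
prover seat `lit-hodgefound-p35` (generation 53, row g53-#8 = gen-52 successor pointer z4; sequel of gen-52 row g52-#6 `ComplexTorusHodgeRationalEndSemisimple`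
(`hodgeRatEnd Φ = End_{ℚ-HS}(H•(X; ℚ))` is a finite semisimple `ℚ`-algebra for a polarisable torus) and g52-#5 `ComplexTorusHodgeRealEndSemisimple`
(quasi-inverses in `†`-stable real subalgebras)). THEOREMS ONLY: no definition, no named fact, no instance, no notation; D-0026 net debt `0`.

THE POINT. André (§4.2, p. 19): "Comme les algèbres d'endomorphismes de motifs sont semi-simples de dimension finie sur `ℚ` (prop. 3.3), on déduit du lemme 2 de
[J92] que [la catégorie] est abélienne semi-simple" — the mechanism being that in a semisimple ring every element `u` has a QUASI-INVERSE `v` (`u v u = u`,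
von Neumann regularity, Lam (4.27)/(4.24)), whence `e = u v` and `f = v u` are IDEMPOTENTS of the ring with `im e = im u`, `ker f = ker u`: images and kernels of
morphisms are direct summands cut out by projectors of the same algebra. This file proves the ring-theoretic step in general (§1–§2) and applies it to the torus'
`End_{ℚ-HS}(H•(X; ℚ)) = hodgeRatEnd Φ` (§3: for a polarisable torus every rational Hodge endomorphism of the total cohomology has a rational Hodge quasi-inverse,
and its image / kernel is the image / kernel of a rational Hodge projector, with a rational Hodge complement) and to `†`-stable real subalgebras
`S ⊆ End_{ℝ-HS}` (§4, from row g52-#5's quasi-inverses).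

## What is proved

* §1 (any semisimple ring) **`exists_mul_mul_eq_self_of_isSemisimpleRing`** (`∀ a, ∃ x, a x a = a`: a complement of the left ideal `R a` splits `1`),
  `isIdempotentElem_mul_of_mul_mul_eq_self` / `…_mul_of_mul_mul_eq_self'` (`a x`, `x a` are idempotents).
* §2 (linear maps with `u v u = u`) `range_mul_eq_of_mul_mul_eq_self` (`im (u v) = im u`), `ker_mul_eq_of_mul_mul_eq_self` (`ker (v u) = ker u`),
  `isCompl_range_ker_of_mul_mul_eq_self` (`im u ⊕ ker (u v) = everything`), `isCompl_range_ker_of_mul_mul_eq_self'` (`im (v u) ⊕ ker u`).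
* §3 (torus, `η ∈ NS(X) ⊗ ℚ` of type (1,1) with `η(iu, u) > 0`, `e : Fin (2g) ≃ ι`) **`IsNSForm.exists_mul_mul_eq_self_of_mem_hodgeRatEnd`** (von Neumann regularity
  of `End_{ℚ-HS}(H•(X; ℚ))`), **`IsNSForm.exists_isIdempotentElem_range_eq_of_mem_hodgeRatEnd`** (a rational Hodge projector `p ∈ u · End_{ℚ-HS}` onto `im u`, with
  `im u ⊕ ker p = H•`), `IsNSForm.exists_isIdempotentElem_ker_eq_of_mem_hodgeRatEnd` (one with kernel `ker u`); the `IsRiemannForm.…` forms.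
* §4 (real, `†`-stable non-unital `S ⊆ End_{ℝ-HS}`, `η` a Kähler datum) `exists_isIdempotentElem_mem_range_eq_of_andreDagger_mem` (an `S`-projector onto `im u` for
  `u ∈ S`).

## Sources, VERBATIM

* Y. André, *Pour une théorie inconditionnelle des motifs*, Publ. Math. IHÉS **83** (1996) [Andre1996Motifs], §4.2 (p. 19): "Comme les algèbres d'endomorphismes de
  motifs sont semi-simples de dimension finie sur `ℚ` (prop. 3.3), on déduit du lemme 2 de [J92] que `ℳ_K(𝒱)` est abélienne semi-simple."; Prop. 3.3 (p. 21);
  Appendice Remarque 1 (p. 47).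
* U. Jannsen, *Motives, numerical equivalence, and semi-simplicity*, Invent. Math. **107** (1992) [Jannsen1992Motives], Lemma 2.
* T. Y. Lam, *A First Course in Noncommutative Rings* (2001) [Lam2001FirstCourse], (4.24), (4.27) (semisimple rings are von Neumann regular: "`a = axa`").
* I. N. Herstein, *Noncommutative Rings* [Herstein1994], Thm. 1.4.2 (as used by row g52-#5).

## Scope

Nothing is said about abelian categories as such (no category is built); the statements are about the rings `hodgeRatEnd Φ`, `hodgeRealEnd E` acting on `H•(X; ℂ)`.
-/

noncomputable section

-- instance search through the subalgebra `hodgeRatEnd Φ` of `Module.End ℂ (GForm E ℂ)` (row g52-#5/#6 precedent)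
set_option synthInstance.maxHeartbeats 400000
set_option maxSynthPendingDepth 3

namespace Literature.Geometry.Kaehler

namespace ComplexTorus

open Module Function
open Literature.LinearAlgebra.Alternating Literature.Algebra.Lie Literature.Analysis.Complex

/-! ## §1 Semisimple rings are von Neumann regular -/

section Ring

/-- **Every element of a semisimple ring has a quasi-inverse: `∃ x, a x a = a`** (the left ideal `R a` has a complement `J`; write `1 = x a + j`, then
`a j = a − a x a ∈ R a ∩ J = 0`). [cite: Lam2001FirstCourse, (4.27)] [cite: Andre1996Motifs, §4.2 (p. 19)] -/
theorem exists_mul_mul_eq_self_of_isSemisimpleRing {R : Type*} [Ring R] [IsSemisimpleRing R] (a : R) : ∃ x : R, a * x * a = a := by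
  obtain ⟨J, hJ⟩ := exists_isCompl (Submodule.span R {a} : Submodule R R)
  have h1 : (1 : R) ∈ Submodule.span R {a} ⊔ J := by rw [hJ.sup_eq_top]; exact Submodule.mem_top
  obtain ⟨i, hi, j, hj, hij⟩ := Submodule.mem_sup.1 h1
  obtain ⟨x, rfl⟩ := Submodule.mem_span_singleton.1 hi
  refine ⟨x, ?_⟩
  have haj : a * j ∈ Submodule.span R {a} ⊓ J := by
    refine ⟨?_, J.smul_mem a hj⟩
    have h2 : a * j = a - a * (x • a) := by rw [eq_sub_iff_add_eq, add_comm, ← mul_add, hij, mul_one]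
    rw [h2]
    exact Submodule.sub_mem _ (Submodule.mem_span_singleton_self a) (Submodule.smul_mem _ a hi)
  rw [hJ.inf_eq_bot, Submodule.mem_bot] at haj
  calc a * x * a = a * (x • a) + a * j := by rw [haj, add_zero, smul_eq_mul, mul_assoc]
    _ = a := by rw [← mul_add, hij, mul_one]

/-- `a x a = a ⇒ (a x)² = a x`. [cite: Lam2001FirstCourse, (4.27)] -/
theorem isIdempotentElem_mul_of_mul_mul_eq_self {R : Type*} [Semigroup R] {a x : R} (h : a * x * a = a) : IsIdempotentElem (a * x) := by
  change a * x * (a * x) = a * x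
  rw [← mul_assoc, h]

/-- `a x a = a ⇒ (x a)² = x a`. [cite: Lam2001FirstCourse, (4.27)] -/
theorem isIdempotentElem_mul_of_mul_mul_eq_self' {R : Type*} [Semigroup R] {a x : R} (h : a * x * a = a) : IsIdempotentElem (x * a) := by
  change x * a * (x * a) = x * a
  rw [mul_assoc, ← mul_assoc a, h]

end Ring

/-! ## §2 Quasi-inverses of linear maps: images and kernels are those of idempotents -/

section Linear

variable {K V : Type*} [Semiring K] [AddCommMonoid V] [Module K V]

/-- **`im (u v) = im u`** when `u v u = u`. [cite: Jannsen1992Motives, Lemma 2] -/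
theorem range_mul_eq_of_mul_mul_eq_self {u v : Module.End K V} (h : u * v * u = u) : LinearMap.range (u * v) = LinearMap.range u := by
  refine le_antisymm ?_ ?_
  · rw [Module.End.mul_eq_comp]; exact LinearMap.range_comp_le_range _ _
  · conv_lhs => rw [← h, Module.End.mul_eq_comp]
    exact LinearMap.range_comp_le_range _ _

/-- **`ker (v u) = ker u`** when `u v u = u`. [cite: Jannsen1992Motives, Lemma 2] -/
theorem ker_mul_eq_of_mul_mul_eq_self {u v : Module.End K V} (h : u * v * u = u) : LinearMap.ker (v * u) = LinearMap.ker u := by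
  refine le_antisymm ?_ ?_
  · conv_rhs => rw [← h, mul_assoc, Module.End.mul_eq_comp]
    exact LinearMap.ker_le_ker_comp _ _
  · rw [Module.End.mul_eq_comp]; exact LinearMap.ker_le_ker_comp _ _

variable {K V : Type*} [Ring K] [AddCommGroup V] [Module K V]

/-- **`im u ⊕ ker (u v) = V`** when `u v u = u` (`u v` is a projector onto `im u`). [cite: Jannsen1992Motives, Lemma 2] [cite: Lam2001FirstCourse, (4.27)] -/
theorem isCompl_range_ker_of_mul_mul_eq_self {u v : Module.End K V} (h : u * v * u = u) : IsCompl (LinearMap.range u) (LinearMap.ker (u * v)) := by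
  rw [← range_mul_eq_of_mul_mul_eq_self h]
  exact ((u * v).isProj_range_iff_isIdempotentElem.2 (isIdempotentElem_mul_of_mul_mul_eq_self h)).isCompl

/-- **`im (v u) ⊕ ker u = V`** when `u v u = u` (`v u` is a projector along `ker u`). [cite: Jannsen1992Motives, Lemma 2] [cite: Lam2001FirstCourse, (4.27)] -/
theorem isCompl_range_ker_of_mul_mul_eq_self' {u v : Module.End K V} (h : u * v * u = u) : IsCompl (LinearMap.range (v * u)) (LinearMap.ker u) := by
  rw [← ker_mul_eq_of_mul_mul_eq_self h]
  exact ((v * u).isProj_range_iff_isIdempotentElem.2 (isIdempotentElem_mul_of_mul_mul_eq_self' h)).isCompl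

end Linear

/-! ## §3 Rational Hodge endomorphisms of `H•(X; ℚ)`: quasi-inverses and projectors -/

section Rational

universe uE

variable {ι : Type*} [Fintype ι] [DecidableEq ι] {E : Type uE} [NormedAddCommGroup E] [NormedSpace ℂ E] [FiniteDimensional ℂ E]
  (Φ : (ι → ℝ) ≃L[ℝ] E) {η : E [⋀^Fin 2]→L[ℝ] ℝ} [Nontrivial E]
  (h11 : ∀ u v : E, η ![Complex.I • u, Complex.I • v] = η ![u, v]) (hpos : ∀ u : E, u ≠ 0 → 0 < η ![Complex.I • u, u])
  (hη : ∀ v : E, v ≠ 0 → ∃ w : E, η ![v, w] ≠ 0) {g : ℕ} (e : Fin (2 * g) ≃ ι)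

include h11 hpos hη e in
/-- **VON NEUMANN REGULARITY OF `End_{ℚ-HS}(H•(X; ℚ))`: every rational Hodge endomorphism `u` of the total cohomology of a polarised complex torus (`η ∈ NS(X) ⊗ ℚ` of type
(1,1), `η(iu, u) > 0`, `e : Fin (2g) ≃ ι`) has a rational Hodge quasi-inverse `v`, `u v u = u`** (row g52-#6: `hodgeRatEnd Φ` is semisimple; §1).
[cite: Andre1996Motifs, Prop. 3.3 (p. 21), §4.2 (p. 19)] [cite: Lam2001FirstCourse, (4.27)] -/
theorem IsNSForm.exists_mul_mul_eq_self_of_mem_hodgeRatEnd (hNS : IsNSForm Φ η) {u : Module.End ℂ (GForm E ℂ)} (hu : u ∈ hodgeRatEnd Φ) :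
    ∃ v ∈ hodgeRatEnd Φ, u * v * u = u := by
  haveI := hNS.isSemisimpleRing_hodgeRatEnd Φ h11 hpos hη e
  obtain ⟨x, hx⟩ := exists_mul_mul_eq_self_of_isSemisimpleRing (⟨u, hu⟩ : hodgeRatEnd Φ)
  exact ⟨x, x.2, congrArg Subtype.val hx⟩

include h11 hpos hη e in
/-- **THE IMAGE OF A RATIONAL HODGE ENDOMORPHISM IS CUT OUT BY A RATIONAL HODGE PROJECTOR**: for `u ∈ End_{ℚ-HS}(H•(X; ℚ))` there is an idempotent
`p = u v ∈ u · End_{ℚ-HS} ⊆ End_{ℚ-HS}` with `im p = im u`, and `im u ⊕ ker p = H•` — Jannsen's Lemma 2 / André §4.2 ("les endomorphismes idempotents ont un noyau et un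
conoyau") on the torus. [cite: Andre1996Motifs, §4.2 (p. 19)] [cite: Jannsen1992Motives, Lemma 2] -/
theorem IsNSForm.exists_isIdempotentElem_range_eq_of_mem_hodgeRatEnd (hNS : IsNSForm Φ η) {u : Module.End ℂ (GForm E ℂ)} (hu : u ∈ hodgeRatEnd Φ) :
    ∃ p ∈ hodgeRatEnd Φ, IsIdempotentElem p ∧ LinearMap.range p = LinearMap.range u ∧ IsCompl (LinearMap.range u) (LinearMap.ker p) ∧
      ∃ v ∈ hodgeRatEnd Φ, p = u * v := by
  obtain ⟨v, hv, h⟩ := hNS.exists_mul_mul_eq_self_of_mem_hodgeRatEnd Φ h11 hpos hη e hu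
  exact ⟨u * v, (hodgeRatEnd Φ).mul_mem hu hv, isIdempotentElem_mul_of_mul_mul_eq_self h, range_mul_eq_of_mul_mul_eq_self h,
    isCompl_range_ker_of_mul_mul_eq_self h, v, hv, rfl⟩

include h11 hpos hη e in
/-- **The kernel of a rational Hodge endomorphism is the kernel of a rational Hodge projector** `f = v u ∈ End_{ℚ-HS} · u`, with `im f ⊕ ker u = H•`.
[cite: Andre1996Motifs, §4.2 (p. 19)] [cite: Jannsen1992Motives, Lemma 2] -/
theorem IsNSForm.exists_isIdempotentElem_ker_eq_of_mem_hodgeRatEnd (hNS : IsNSForm Φ η) {u : Module.End ℂ (GForm E ℂ)} (hu : u ∈ hodgeRatEnd Φ) :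
    ∃ f ∈ hodgeRatEnd Φ, IsIdempotentElem f ∧ LinearMap.ker f = LinearMap.ker u ∧ IsCompl (LinearMap.range f) (LinearMap.ker u) ∧
      ∃ v ∈ hodgeRatEnd Φ, f = v * u := by
  obtain ⟨v, hv, h⟩ := hNS.exists_mul_mul_eq_self_of_mem_hodgeRatEnd Φ h11 hpos hη e hu
  exact ⟨v * u, (hodgeRatEnd Φ).mul_mem hv hu, isIdempotentElem_mul_of_mul_mul_eq_self' h, ker_mul_eq_of_mul_mul_eq_self h,
    isCompl_range_ker_of_mul_mul_eq_self' h, v, hv, rfl⟩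

include e in
/-- For a Riemann form (polarised abelian variety): **every `u ∈ End_{ℚ-HS}(H•(X; ℚ))` has a rational Hodge quasi-inverse.** [cite: Andre1996Motifs, Prop. 3.3 (p. 21), §4.2 (p. 19)]
[cite: Lam2001FirstCourse, (4.27)] -/
theorem IsRiemannForm.exists_mul_mul_eq_self_of_mem_hodgeRatEnd (hR : IsRiemannForm Φ η) {u : Module.End ℂ (GForm E ℂ)} (hu : u ∈ hodgeRatEnd Φ) :
    ∃ v ∈ hodgeRatEnd Φ, u * v * u = u :=
  (hR.isNSForm Φ).exists_mul_mul_eq_self_of_mem_hodgeRatEnd Φ hR.1 hR.2.2 (hR.exists_apply_ne_zero Φ) e hu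

include e in
/-- For a Riemann form: **the image of every rational Hodge endomorphism of `H•(X; ℚ)` is the image of a rational Hodge projector `p ∈ u · End_{ℚ-HS}` and
`im u ⊕ ker p = H•`.** [cite: Andre1996Motifs, §4.2 (p. 19)] [cite: Jannsen1992Motives, Lemma 2] -/
theorem IsRiemannForm.exists_isIdempotentElem_range_eq_of_mem_hodgeRatEnd (hR : IsRiemannForm Φ η) {u : Module.End ℂ (GForm E ℂ)} (hu : u ∈ hodgeRatEnd Φ) :
    ∃ p ∈ hodgeRatEnd Φ, IsIdempotentElem p ∧ LinearMap.range p = LinearMap.range u ∧ IsCompl (LinearMap.range u) (LinearMap.ker p) ∧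
      ∃ v ∈ hodgeRatEnd Φ, p = u * v :=
  (hR.isNSForm Φ).exists_isIdempotentElem_range_eq_of_mem_hodgeRatEnd Φ hR.1 hR.2.2 (hR.exists_apply_ne_zero Φ) e hu

include e in
/-- For a Riemann form: **the kernel of every rational Hodge endomorphism of `H•(X; ℚ)` is the kernel of a rational Hodge projector `f ∈ End_{ℚ-HS} · u` and
`im f ⊕ ker u = H•`.** [cite: Andre1996Motifs, §4.2 (p. 19)] [cite: Jannsen1992Motives, Lemma 2] -/
theorem IsRiemannForm.exists_isIdempotentElem_ker_eq_of_mem_hodgeRatEnd (hR : IsRiemannForm Φ η) {u : Module.End ℂ (GForm E ℂ)} (hu : u ∈ hodgeRatEnd Φ) :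
    ∃ f ∈ hodgeRatEnd Φ, IsIdempotentElem f ∧ LinearMap.ker f = LinearMap.ker u ∧ IsCompl (LinearMap.range f) (LinearMap.ker u) ∧
      ∃ v ∈ hodgeRatEnd Φ, f = v * u :=
  (hR.isNSForm Φ).exists_isIdempotentElem_ker_eq_of_mem_hodgeRatEnd Φ hR.1 hR.2.2 (hR.exists_apply_ne_zero Φ) e hu

end Rational

/-! ## §4 Real `†`-stable subalgebras of `End_{ℝ-HS}`: images of `S`-operators have `S`-projectors -/

section Real

universe uE

variable {ι : Type*} [Fintype ι] [DecidableEq ι] {E : Type uE} [NormedAddCommGroup E] [NormedSpace ℂ E] [FiniteDimensional ℂ E]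
  (Φ : (ι → ℝ) ≃L[ℝ] E) {η : E [⋀^Fin 2]→L[ℝ] ℝ} {g : ℕ} [Nontrivial E]

/-- **For a `†`-stable non-unital real subalgebra `S ⊆ End_{ℝ-HS}(H•(X; ℝ))` (`η` a Kähler datum) and `u ∈ S` there is an idempotent `e ∈ S` with `im e = im u` and
`im u ⊕ ker e = H•`** — the images of `S`-operators are `S`-split (row g52-#5's quasi-inverses `u v u = u`, `v ∈ S`; `e = u v`).
[cite: Andre1996Motifs, Appendice Remarque 1 (p. 47), Prop. 3.3 (pp. 21–22), §4.2 (p. 19)] [cite: Herstein1994, Thm. 1.4.2] -/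
theorem exists_isIdempotentElem_mem_range_eq_of_andreDagger_mem (h11 : ∀ u v : E, η ![Complex.I • u, Complex.I • v] = η ![u, v])
    (hpos : ∀ u : E, u ≠ 0 → 0 < η ![Complex.I • u, u]) (hη : ∀ v : E, v ≠ 0 → ∃ w : E, η ![v, w] ≠ 0) (e : Fin (2 * g) ≃ ι)
    (S : NonUnitalSubalgebra ℝ (Module.End ℂ (GForm E ℂ))) (hS : ∀ u ∈ S, u ∈ hodgeRealEnd E) (hSdag : ∀ u ∈ S, andreDagger Φ hη e u ∈ S)
    {u : Module.End ℂ (GForm E ℂ)} (hu : u ∈ S) :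
    ∃ p ∈ S, IsIdempotentElem p ∧ LinearMap.range p = LinearMap.range u ∧ IsCompl (LinearMap.range u) (LinearMap.ker p) := by
  obtain ⟨v, hv, h⟩ := exists_mul_mul_eq_self_of_andreDagger_mem Φ h11 hpos hη e S hS hSdag hu
  exact ⟨u * v, S.mul_mem hu hv, isIdempotentElem_mul_of_mul_mul_eq_self h, range_mul_eq_of_mul_mul_eq_self h, isCompl_range_ker_of_mul_mul_eq_self h⟩

/-- … and **an idempotent `f ∈ S` with `ker f = ker u`, `im f ⊕ ker u = H•`** (`f = v u`). [cite: Andre1996Motifs, Appendice Remarque 1 (p. 47), §4.2 (p. 19)]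
[cite: Herstein1994, Thm. 1.4.2] -/
theorem exists_isIdempotentElem_mem_ker_eq_of_andreDagger_mem (h11 : ∀ u v : E, η ![Complex.I • u, Complex.I • v] = η ![u, v])
    (hpos : ∀ u : E, u ≠ 0 → 0 < η ![Complex.I • u, u]) (hη : ∀ v : E, v ≠ 0 → ∃ w : E, η ![v, w] ≠ 0) (e : Fin (2 * g) ≃ ι)
    (S : NonUnitalSubalgebra ℝ (Module.End ℂ (GForm E ℂ))) (hS : ∀ u ∈ S, u ∈ hodgeRealEnd E) (hSdag : ∀ u ∈ S, andreDagger Φ hη e u ∈ S)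
    {u : Module.End ℂ (GForm E ℂ)} (hu : u ∈ S) :
    ∃ f ∈ S, IsIdempotentElem f ∧ LinearMap.ker f = LinearMap.ker u ∧ IsCompl (LinearMap.range f) (LinearMap.ker u) := by
  obtain ⟨v, hv, h⟩ := exists_mul_mul_eq_self_of_andreDagger_mem Φ h11 hpos hη e S hS hSdag hu
  exact ⟨v * u, S.mul_mem hv hu, isIdempotentElem_mul_of_mul_mul_eq_self' h, ker_mul_eq_of_mul_mul_eq_self h, isCompl_range_ker_of_mul_mul_eq_self' h⟩

end Real

end ComplexTorus

end Literature.Geometry.Kaehler
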